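import Mathlib
import HarnessLib
import Summits.NavierStokesRegularity.NavierStokesRegularity.Theorems.PoloidalWindowDoorPoloidalWindowRigidityLocalVorticitySymmetry
import Summits.NavierStokesRegularity.NavierStokesRegularity.Theorems.PoloidalWindowDoorPoloidalWindowRigiditySymmetryGerms
import Summits.NavierStokesRegularity.NavierStokesRegularity.Theorems.PoloidalWindowDoorPoloidalWindowRigidityOneSliceCurlAxisymmetric

/-!
# Route `PoloidalWindowDoor`, crux `PoloidalWindowRigidity` (K2, stmt-NavierStokesRegularity-19708), line «lrc-jet» v2 —
# JET COMPACTNESS: infinitesimal symmetries at EVERY finite order at one point ⇒ a symmetry GERM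
# (the order-independent half of «jet ⇒ germ», stub_lrcOfJet, for stub_lrcSpatial's endgame)

Cell ns-regularity-ideate, seat ns-poloidal-K2-p3 gen 4 (stub-worker under the K2 lead ns-poloidal-K2-p1 g4; file landed
`--supports stmt-NavierStokesRegularity-19708` as a helper).

The certificate programme of the line (ns-poloidal-K2-cert-1, nsreg-p7 g8) proves, order by order, that at a non-degenerate
poloidal NS jet every admissible vorticity jet is infinitesimally Killing-symmetric: for each truncation order `N` there is a
NONZERO element `K` of a finite-dimensional Lie algebra of Killing fields whose Lie derivative `L_K ω` vanishes through order
`N` at the base point.  The Killing field may depend on `N`.  This file turns such order-by-order statements into the GERM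
statement that the glue `…K2OfLrcSpatial.nonflatLiouville_of_lrc_spatial` consumes — with no reference to the order `N*`:

* `exists_combination_eventuallyEq_zero` — ABSTRACT COMPACTNESS: `L₁,…,L_d` analytic at `y₀`; if for every `N` some
  `p ≠ 0` in `ℝ^d` kills the `N`-jet of `Σ pᵢ Lᵢ` at `y₀` (`∀ n ≤ N, Σ pᵢ • Dⁿ Lᵢ(y₀) = 0`), then ONE `p ≠ 0` has
  `Σ pᵢ Lᵢ ≡ 0` near `y₀`.  (The kernels `V_N = {p : the N-jet vanishes}` form a decreasing chain of nonzero subspaces of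
  `ℝ^d`; it stabilises; a vector in the stable kernel has ALL jets zero, and an analytic function with vanishing Taylor
  series vanishes near the point, `HasFPowerSeriesOnBall.hasSum_iteratedFDeriv`.)
* `lrc_germ_of_killing_jets` — VORTICITY COROLLARY (one slice `s < 0` of a profile of the class; the horizontal Euclidean
  algebra `𝔨_h = span{e₀, e₁, J}`; `L_K ω = Dω[K] − κ Jω` for `K = p₀e₀ + p₁e₁ + p₂ J`): if for every `N` some nonzero
  `K ∈ 𝔨_h` kills the `N`-jet of `L_K ω` at `y₀`, then on a neighbourhood of `y₀` the vorticity has a TRANSLATION GERM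
  (`Dω[e] = 0`, `e ≠ 0` horizontal) or a ROTATION GERM about a vertical axis (`Jω(y) = Dω(y)[J(y − c)]`) — verbatim the
  two disjuncts of `hLRC` in `…K2OfLrcSpatial` / Lines-lrc-jet v2 `stub_lrcSpatial`.
* `nonflatLiouville_of_killing_jets` — hence (class + poloidal) such a profile is not backward-singular (this seat's
  p509715 / nsreg-p7's p513035).

WHAT THIS IS NOT: not a claim about Navier–Stokes regularity, not LRC″ — a compactness lemma; the all-orders infinitesimal
statement it consumes is the research content of stub_lrcSpatial (bears_on LADDER-NS N0 via crux K2 = stmt-19708).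
-/

noncomputable section

-- the summit and its single sub-problem share the name (CONVENTIONS §1), as in every Theorems file
set_option linter.dupNamespace false

namespace Summit.NavierStokesRegularity.NavierStokesRegularity.Theorems.PoloidalWindowDoorPoloidalWindowRigidityKillingJetCompactness

open Set Function Filter Topology Metric
open scoped RealInnerProductSpace InnerProductSpace Nat
open Literature.Analysis Literature.Analysis.FluidPDE
open Summit.NavierStokesRegularity.NavierStokesRegularity.Theorems.LocalSineTubeDoorProfileAlignedWindowRigidityAncient
open Summit.NavierStokesRegularity.NavierStokesRegularity.Theorems.PoloidalWindowDoorPoloidalWindowRigidityLocalVorticitySymmetry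
open Summit.NavierStokesRegularity.NavierStokesRegularity.Theorems.PoloidalWindowDoorPoloidalWindowRigiditySymmetryGerms
open Summit.NavierStokesRegularity.NavierStokesRegularity.Theorems.PoloidalWindowDoorPoloidalWindowRigidityOneSliceCurlAxisymmetric
open Summit.NavierStokesRegularity.NavierStokesRegularity.Theorems.PoloidalWindowDoorPoloidalWindowRigidityOneSliceCurlAxisymmetric

/-! ### Abstract jet compactness in a finite-dimensional family -/

section Abstract

variable {E F : Type*} [NormedAddCommGroup E] [NormedSpace ℝ E] [NormedAddCommGroup F] [NormedSpace ℝ F]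
  [CompleteSpace F] {ι : Type*} [Fintype ι]

/-- **Vanishing Taylor series ⇒ vanishing germ.**  An analytic function at `y₀` all of whose iterated derivatives at
`y₀` vanish is zero near `y₀`. -/
theorem eventuallyEq_zero_of_iteratedFDeriv_eq_zero {f : E → F} {y₀ : E} (hf : AnalyticAt ℝ f y₀)
    (h : ∀ n : ℕ, iteratedFDeriv ℝ n f y₀ = 0) : f =ᶠ[𝓝 y₀] 0 := by
  obtain ⟨q, r, hq⟩ := hf
  have hr : 0 < r := hq.r_pos
  filter_upwards [Metric.eball_mem_nhds y₀ hr] with z hz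
  have hy : z - y₀ ∈ Metric.eball (0 : E) r := by
    rw [Metric.mem_eball, edist_zero_right, ← edist_eq_enorm_sub]; exact Metric.mem_eball.1 hz
  have hsum := hq.hasSum_iteratedFDeriv hy
  have hzero : (fun n : ℕ => ((n ! : ℝ))⁻¹ • iteratedFDeriv ℝ n f y₀ fun _ => z - y₀) = fun _ => 0 := by
    funext n; rw [h n]; simp
  rw [hzero, add_sub_cancel] at hsum
  exact hsum.unique hasSum_zero

/-- **ABSTRACT JET COMPACTNESS.**  Let `L : ι → E → F` be finitely many functions analytic at `y₀`.  If for every order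
`N` some nonzero parameter `p : ι → ℝ` kills the `N`-jet of `Σ pᵢ Lᵢ` at `y₀` — `∀ n ≤ N, Σᵢ pᵢ • iteratedFDeriv ℝ n (Lᵢ) y₀ = 0`
— then ONE nonzero `p` makes `Σ pᵢ Lᵢ` vanish on a neighbourhood of `y₀`. -/
theorem exists_combination_eventuallyEq_zero (L : ι → E → F) (y₀ : E) (hL : ∀ i, AnalyticAt ℝ (L i) y₀)
    (hjet : ∀ N : ℕ, ∃ p : ι → ℝ, p ≠ 0 ∧ ∀ n ≤ N, ∑ i, p i • iteratedFDeriv ℝ n (L i) y₀ = 0) :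
    ∃ p : ι → ℝ, p ≠ 0 ∧ (fun y => ∑ i, p i • L i y) =ᶠ[𝓝 y₀] 0 := by
  classical
  -- the kernels `V N = {p : the N-jet of Σ pᵢ Lᵢ vanishes at y₀}`, a decreasing chain of subspaces of `ι → ℝ`
  let V : ℕ → Submodule ℝ (ι → ℝ) := fun N =>
    { carrier := {p | ∀ n ≤ N, ∑ i, p i • iteratedFDeriv ℝ n (L i) y₀ = 0}
      add_mem' := by
        intro p q hp hq n hn
        have e : ∑ i, (p + q) i • iteratedFDeriv ℝ n (L i) y₀ =
            ∑ i, p i • iteratedFDeriv ℝ n (L i) y₀ + ∑ i, q i • iteratedFDeriv ℝ n (L i) y₀ := by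
          rw [← Finset.sum_add_distrib]
          exact Finset.sum_congr rfl fun i _ => by rw [Pi.add_apply, add_smul]
        rw [e, hp n hn, hq n hn, add_zero]
      zero_mem' := by
        intro n _
        simp
      smul_mem' := by
        intro c p hp n hn
        have e : ∑ i, (c • p) i • iteratedFDeriv ℝ n (L i) y₀ = c • ∑ i, p i • iteratedFDeriv ℝ n (L i) y₀ := by
          rw [Finset.smul_sum]
          exact Finset.sum_congr rfl fun i _ => by rw [Pi.smul_apply, smul_eq_mul, smul_smul]
        rw [e, hp n hn, smul_zero] }
  have hmem : ∀ N (p : ι → ℝ), p ∈ V N ↔ ∀ n ≤ N, ∑ i, p i • iteratedFDeriv ℝ n (L i) y₀ = 0 := fun N p => Iff.rfl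
  have hanti : ∀ {N N' : ℕ}, N ≤ N' → V N' ≤ V N := by
    intro N N' hNN' p hp
    rw [hmem] at hp ⊢
    exact fun n hn => hp n (hn.trans hNN')
  have hnebot : ∀ N, V N ≠ ⊥ := by
    intro N
    obtain ⟨p, hp0, hp⟩ := hjet N
    rw [Submodule.ne_bot_iff]
    exact ⟨p, (hmem N p).2 hp, hp0⟩
  -- the dimensions `d N = finrank (V N)` attain a minimum at some `N₀`; there the chain is stable
  set d : ℕ → ℕ := fun N => Module.finrank ℝ (V N) with hd
  obtain ⟨N₀, hN₀⟩ : ∃ N₀, d N₀ = sInf (Set.range d) := Nat.sInf_mem (Set.range_nonempty d)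
  have hmin : ∀ N, d N₀ ≤ d N := fun N => by rw [hN₀]; exact Nat.sInf_le ⟨N, rfl⟩
  have hstable : ∀ N, N₀ ≤ N → V N = V N₀ := fun N hN =>
    Submodule.eq_of_le_of_finrank_le (hanti hN) (hmin N)
  -- a nonzero vector in the stable kernel has ALL jets zero
  obtain ⟨p, hpV, hp0⟩ := (Submodule.ne_bot_iff _).1 (hnebot N₀)
  have hall : ∀ n, ∑ i, p i • iteratedFDeriv ℝ n (L i) y₀ = 0 := by
    intro n
    have hp' : p ∈ V (max n N₀) := by rw [hstable _ (le_max_right _ _)]; exact hpV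
    exact (hmem _ p).1 hp' n (le_max_left _ _)
  refine ⟨p, hp0, ?_⟩
  -- the combination `f = Σ pᵢ Lᵢ` is analytic at `y₀` with vanishing Taylor series
  have hfan : AnalyticAt ℝ (fun y => ∑ i, p i • L i y) y₀ :=
    Finset.analyticAt_fun_sum Finset.univ fun i _ => (analyticAt_const (v := p i)).smul (hL i)
  refine eventuallyEq_zero_of_iteratedFDeriv_eq_zero hfan fun n => ?_
  have hcd : ∀ i ∈ (Finset.univ : Finset ι), ContDiffAt ℝ n (fun y => p i • L i y) y₀ :=
    fun i _ => (contDiffAt_const (c := p i)).smul ((hL i).contDiffAt (n := n))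
  rw [iteratedFDeriv_fun_sum_apply hcd, ← hall n]
  exact Finset.sum_congr rfl fun i _ => iteratedFDeriv_const_smul_apply' ((hL i).contDiffAt (n := n))

end Abstract

/-! ### The vorticity of a class profile and the horizontal Euclidean algebra -/

section Vorticity

variable {C : ℝ} {v : ℝ → EuclideanSpace ℝ (Fin 3) → EuclideanSpace ℝ (Fin 3)}

/-- `J e₀ = e₁`. -/
theorem rotGen_single_zero :
    rotGen (EuclideanSpace.single 0 (1 : ℝ)) = (EuclideanSpace.single 1 (1 : ℝ) : EuclideanSpace ℝ (Fin 3)) := by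
  ext i; fin_cases i <;> simp [rotGen]

/-- `J e₁ = −e₀`. -/
theorem rotGen_single_one :
    rotGen (EuclideanSpace.single 1 (1 : ℝ)) = -(EuclideanSpace.single 0 (1 : ℝ) : EuclideanSpace ℝ (Fin 3)) := by
  ext i; fin_cases i <;> simp [rotGen]

/-- **JETS ⇒ GERM FOR THE VORTICITY (horizontal Euclidean algebra).**  Let `v` be a profile of the route's Type-I class,
`s < 0` a slice, `ω = curl v(s)`, `y₀` a point.  The horizontal Euclidean algebra acts on `ω` through the three analytic
fields `L₀ = Dω[e₀]`, `L₁ = Dω[e₁]`, `L₂ = Dω[J·] − Jω` (`L_K ω` for `K = p₀e₀ + p₁e₁ + p₂J`).  If for EVERY order `N` some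
nonzero `p ∈ ℝ³` kills the `N`-jet of `p₀L₀ + p₁L₁ + p₂L₂` at `y₀`, then on a nonempty open set the vorticity has a
translation germ along a nonzero (horizontal) direction or a rotation germ about a vertical axis — the two disjuncts of
`hLRC` in `…K2OfLrcSpatial.nonflatLiouville_of_lrc_spatial`. -/
theorem lrc_germ_of_killing_jets (hrate : HasTypeITimeDecay C v)
    (hcont : ContinuousOn (uncurry v) (Iio (0 : ℝ) ×ˢ univ))
    (hmild : ∀ s t : ℝ, s < t → t < 0 → ∀ x,
      v t x = UnboundedOperators.heatExtension (v s) (t - s) x - oseenDuhamel 1 s v v t x)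
    {s : ℝ} (hs : s < 0) (y₀ : EuclideanSpace ℝ (Fin 3))
    (hjet : ∀ N : ℕ, ∃ p : Fin 3 → ℝ, p ≠ 0 ∧ ∀ n ≤ N,
      p 0 • iteratedFDeriv ℝ n (fun y => fderiv ℝ (curl (v s)) y (EuclideanSpace.single 0 1)) y₀ +
      p 1 • iteratedFDeriv ℝ n (fun y => fderiv ℝ (curl (v s)) y (EuclideanSpace.single 1 1)) y₀ +
      p 2 • iteratedFDeriv ℝ n (fun y => fderiv ℝ (curl (v s)) y (rotGen y) - rotGen (curl (v s) y)) y₀ = 0) :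
    ∃ U : Set (EuclideanSpace ℝ (Fin 3)), IsOpen U ∧ U.Nonempty ∧
      ((∃ e : EuclideanSpace ℝ (Fin 3), e ≠ 0 ∧ ∀ y ∈ U, fderiv ℝ (curl (v s)) y e = 0) ∨
       (∃ c : EuclideanSpace ℝ (Fin 3), ∀ y ∈ U,
          rotGen (curl (v s) y) = fderiv ℝ (curl (v s)) y (rotGen (y - c)))) := by
  set ω : EuclideanSpace ℝ (Fin 3) → EuclideanSpace ℝ (Fin 3) := curl (v s) with hω
  have hanC : AnalyticOnNhd ℝ ω univ := analyticOnNhd_curl_slice hrate hcont hmild hs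
  -- the three generators
  set L : Fin 3 → EuclideanSpace ℝ (Fin 3) → EuclideanSpace ℝ (Fin 3) :=
    ![fun y => fderiv ℝ ω y (EuclideanSpace.single 0 1), fun y => fderiv ℝ ω y (EuclideanSpace.single 1 1),
      fun y => fderiv ℝ ω y (rotGen y) - rotGen (ω y)] with hL
  have hanD : AnalyticOnNhd ℝ (fderiv ℝ ω) univ := hanC.fderiv
  have hLe : ∀ e : EuclideanSpace ℝ (Fin 3), AnalyticOnNhd ℝ (fun y => fderiv ℝ ω y e) univ := fun e y hy =>
    ((ContinuousLinearMap.apply ℝ (EuclideanSpace ℝ (Fin 3)) e).analyticAt _).comp (hanD y hy)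
  have hL0 := hLe (EuclideanSpace.single 0 (1 : ℝ))
  have hL1 := hLe (EuclideanSpace.single 1 (1 : ℝ))
  have hL2 : AnalyticOnNhd ℝ (fun y => fderiv ℝ ω y (rotGen y) - rotGen (ω y)) univ := by
    have h1 : AnalyticOnNhd ℝ (fun y => fderiv ℝ ω y (rotGen y)) univ := analyticOnNhd_fderiv_apply hanC analyticOnNhd_rotGen
    have h2 : AnalyticOnNhd ℝ (fun y => rotGen (ω y)) univ := by
      have e : (fun y => rotGen (ω y)) = rotGenL ∘ ω := by funext y; simp
      rw [e]; exact rotGenL.comp_analyticOnNhd hanC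
    exact h1.sub h2
  have hLan : ∀ i, AnalyticAt ℝ (L i) y₀ := by
    intro i
    fin_cases i
    · exact hL0 y₀ (mem_univ _)
    · exact hL1 y₀ (mem_univ _)
    · exact hL2 y₀ (mem_univ _)
  -- the abstract compactness
  have hjet' : ∀ N : ℕ, ∃ p : Fin 3 → ℝ, p ≠ 0 ∧ ∀ n ≤ N, ∑ i, p i • iteratedFDeriv ℝ n (L i) y₀ = 0 := by
    intro N
    obtain ⟨p, hp0, hp⟩ := hjet N
    refine ⟨p, hp0, fun n hn => ?_⟩
    have h := hp n hn
    simpa [hL, Fin.sum_univ_three] using h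
  obtain ⟨p, hp0, hev⟩ := exists_combination_eventuallyEq_zero L y₀ hLan hjet'
  -- an open ball on which the combination vanishes
  obtain ⟨δ, hδ, hball⟩ := Metric.eventually_nhds_iff_ball.1 hev
  have hid : ∀ y ∈ ball y₀ δ, p 0 • fderiv ℝ ω y (EuclideanSpace.single 0 1) + p 1 • fderiv ℝ ω y (EuclideanSpace.single 1 1) +
      p 2 • (fderiv ℝ ω y (rotGen y) - rotGen (ω y)) = 0 := by
    intro y hy
    have h := hball y hy
    simpa [hL, Fin.sum_univ_three] using h
  refine ⟨ball y₀ δ, isOpen_ball, ⟨y₀, mem_ball_self hδ⟩, ?_⟩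
  by_cases hp2 : p 2 = 0
  · -- translation germ along `e = p₀e₀ + p₁e₁ ≠ 0`
    left
    set e : EuclideanSpace ℝ (Fin 3) := p 0 • EuclideanSpace.single 0 (1 : ℝ) + p 1 • EuclideanSpace.single 1 (1 : ℝ)
      with he
    have he0 : e ≠ 0 := by
      intro h0
      have h0' : p 0 = 0 ∧ p 1 = 0 := by
        have c0 := congrArg (fun w : EuclideanSpace ℝ (Fin 3) => w 0) h0
        have c1 := congrArg (fun w : EuclideanSpace ℝ (Fin 3) => w 1) h0
        simp [he] at c0 c1
        exact ⟨c0, c1⟩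
      apply hp0
      funext i
      fin_cases i
      · exact h0'.1
      · exact h0'.2
      · exact hp2
    refine ⟨e, he0, fun y hy => ?_⟩
    have h := hid y hy
    rw [hp2, zero_smul, add_zero] at h
    rw [he, map_add, map_smul, map_smul]
    exact h
  · -- rotation germ about the vertical axis through `c = (−p₁/p₂, p₀/p₂, 0)`
    right
    set c : EuclideanSpace ℝ (Fin 3) := (-(p 1 / p 2)) • EuclideanSpace.single 0 (1 : ℝ) +
      (p 0 / p 2) • EuclideanSpace.single 1 (1 : ℝ) with hc
    refine ⟨c, fun y hy => ?_⟩
    have h := hid y hy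
    -- divide by `p₂` and regroup inside the derivative
    have hrc : rotGen (y - c) = rotGen y + (p 0 / p 2) • EuclideanSpace.single 0 (1 : ℝ) +
        (p 1 / p 2) • EuclideanSpace.single 1 (1 : ℝ) := by
      have e1 : rotGen (y - c) = rotGen y - rotGen c := by
        rw [← rotGenL_apply, ← rotGenL_apply, ← rotGenL_apply, map_sub]
      have e2 : rotGen c = (-(p 1 / p 2)) • rotGen (EuclideanSpace.single 0 (1 : ℝ)) +
          (p 0 / p 2) • rotGen (EuclideanSpace.single 1 (1 : ℝ)) := by
        rw [hc, rotGen_add, rotGen_smul, rotGen_smul]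
      rw [e1, e2, rotGen_single_zero, rotGen_single_one]
      module
    rw [hrc, map_add, map_add, map_smul, map_smul]
    -- from `p₀L₀ + p₁L₁ + p₂L₂ = 0`
    have h2 : fderiv ℝ ω y (rotGen y) - rotGen (ω y) =
        -(p 0 / p 2) • fderiv ℝ ω y (EuclideanSpace.single 0 1) - (p 1 / p 2) • fderiv ℝ ω y (EuclideanSpace.single 1 1) := by
      have h3 : p 2 • (fderiv ℝ ω y (rotGen y) - rotGen (ω y)) =
          -(p 0 • fderiv ℝ ω y (EuclideanSpace.single 0 1)) - p 1 • fderiv ℝ ω y (EuclideanSpace.single 1 1) := by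
        rw [← sub_eq_zero]
        have : p 0 • fderiv ℝ ω y (EuclideanSpace.single 0 1) + p 1 • fderiv ℝ ω y (EuclideanSpace.single 1 1) +
            p 2 • (fderiv ℝ ω y (rotGen y) - rotGen (ω y)) = 0 := h
        rw [← this]
        module
      have h4 := congrArg (fun w => (p 2)⁻¹ • w) h3
      simp only [smul_smul, inv_mul_cancel₀ hp2, one_smul, smul_sub, smul_neg] at h4
      rw [h4]
      module
    have h5 : rotGen (ω y) = fderiv ℝ ω y (rotGen y) + (p 0 / p 2) • fderiv ℝ ω y (EuclideanSpace.single 0 1) +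
        (p 1 / p 2) • fderiv ℝ ω y (EuclideanSpace.single 1 1) := by
      rw [sub_eq_iff_eq_add] at h2
      rw [h2]
      module
    exact h5

/-- **All-orders infinitesimal symmetry at one point ⇒ not backward-singular.**  Class + poloidal + the jet hypothesis
of `lrc_germ_of_killing_jets` at ONE point of ONE slice ⇒ `¬ IsBackwardSingularPoint v 0` (translation germ: this seat's
`nonflatLiouville_of_local_curl_translation`, p509715; rotation germ about any vertical axis: nsreg-p7's
`nonflatLiouville_of_curl_rotDefect_eq_zero_on_open`, p513035). -/
theorem nonflatLiouville_of_killing_jets (hrate : HasTypeITimeDecay C v)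
    (hcont : ContinuousOn (uncurry v) (Iio (0 : ℝ) ×ˢ univ))
    (hmild : ∀ s t : ℝ, s < t → t < 0 → ∀ x,
      v t x = UnboundedOperators.heatExtension (v s) (t - s) x - oseenDuhamel 1 s v v t x)
    (hdiv : ∀ t < 0, VectorCalculus.IsDivFree (v t))
    (hpol : ∀ s < 0, ∀ y, ⟪curl (v s) y, EuclideanSpace.single 2 1⟫_ℝ = 0)
    {s : ℝ} (hs : s < 0) (y₀ : EuclideanSpace ℝ (Fin 3))
    (hjet : ∀ N : ℕ, ∃ p : Fin 3 → ℝ, p ≠ 0 ∧ ∀ n ≤ N,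
      p 0 • iteratedFDeriv ℝ n (fun y => fderiv ℝ (curl (v s)) y (EuclideanSpace.single 0 1)) y₀ +
      p 1 • iteratedFDeriv ℝ n (fun y => fderiv ℝ (curl (v s)) y (EuclideanSpace.single 1 1)) y₀ +
      p 2 • iteratedFDeriv ℝ n (fun y => fderiv ℝ (curl (v s)) y (rotGen y) - rotGen (curl (v s) y)) y₀ = 0) :
    ¬ IsBackwardSingularPoint v 0 := by
  obtain ⟨U, hU, hUne, hsym⟩ := lrc_germ_of_killing_jets hrate hcont hmild hs y₀ hjet
  rcases hsym with ⟨e, he, htr⟩ | ⟨c, hrot⟩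
  · exact nonflatLiouville_of_local_curl_translation hrate hcont hmild hdiv hs he hU hUne htr
  · exact nonflatLiouville_of_curl_rotDefect_eq_zero_on_open hrate hcont hmild hdiv hpol c hs hU hUne hrot

end Vorticity

end Summit.NavierStokesRegularity.NavierStokesRegularity.Theorems.PoloidalWindowDoorPoloidalWindowRigidityKillingJetCompactness

end
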